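import Summits.QuantumFields.YangMills.Theorems.BalabanUVNodesN15CurvedGluingCubeSmoothCutDressedDefect
import Summits.QuantumFields.YangMills.Theorems.BalabanUVNodesN15CurvedGluingCubeDressedGeneralRemainderRowAdjointDefectAssembly
import HarnessLib

/-!
# Route «BalabanUVNodes» (cluster K4 «SpineRates»), Track-A DAG node N15 = NE2, BACKGROUND LAYER — THE η-DEFECT OF THE DRESSED SMOOTH-CUT CUBE's ADJOINT REMAINDER ROW BY NAME: dag-n15-w5's
# two-grid assembly `𝔇(X′∘[K′, M_{h′}], X∘[K, M_h]) ≤ 1_S(y)·r₀ᴸ·e^{−ρ₃d}` (`hasMaj_idef_dressedV_comp_commOp_cubeOp_out`, FILE 58's `hDKL`) run at `G₀ := M_{χ̃}N_□`, `G₀′ := M_{χ̃′}N′_□`,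
# all twenty-two flat-piece hypotheses (entries, jets, right entries at both grids and their η-defects, four cut-offs, six jet relations) discharged from FILE 63's left∕right cut rows,
# their defects, and the bumps with their fits (files 31∕34∕35)

Cell `pub-ymgap`, seat `pub-ymgap-dag-n15-w3` (WIDTH SEAT 3∕3 on node N15, director-ym №197 ∕ HUMAN RULING D-0149; plan `W-SEAT-START-LIST.md` §n15 item 3 «LG-vector + background layers at
GENERAL small-field U» — forty-second piece).  `bears_on: R4∕N15 · K3⁸ SpineGivenEndpointR13SepCoPHV (stmt-QuantumFields-27366; K3⁷ 20544 aside — KEY MAP v2)`.  Filed `--kind proof --supports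
stmt-QuantumFields-27366 --as helper` — COUNT-NEUTRAL.  Theorems only; 0 `sorry`.  Imports BY NAME file 35 `…SmoothCutDressedDefect` (`hasMaj_idef_smoothCut_flat`, `hasMaj_idef_jet_smoothCut_flat`;
file 34 `hasMaj_smoothCut_flat`, `hasMaj_jet_smoothCut_flat`; file 31 `smoothCut_out`, `smoothCut_in`) and dag-n15-w5's `…CubeDressedGeneralRemainderRowAdjointDefectAssembly`
(`hasMaj_idef_dressedV_comp_commOp_cubeOp_out`); nothing in the tree is modified; nothing of dag-n15-w5's restated.

WHY.  File 32's two-grid gluing (`hasMaj_idef_glued_of_cutRows_defect`) and FILE 58's bundle need, per cube, the η-defect of the ADJOINT remainder row (`hDKL`).  dag-n15-w5 g2 assembled it for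
the general dressed cube with the structural perturbation `V̂ = V(C, A) + N_V∘pr₀`; this file is the one-call instantiation at the dressed SMOOTH-CUT cube of both grids (file 41 is the letter):
`β ↦ β̄`, `β₂ ↦ β̄^Q`, `m_G ↦ m̄ = (m₀ + o_χβ) + (m₁ + o_χ₁β₁ + c̃m₀ + o_χ₂β)`, `m_Q ↦ m̄^Q` (the same at `β^Q, β^Q₁, m^Q₀, m^Q₁`); every partition ∕ species ∕ `W`-row ∕ nonlocal ∕ base-perturbation
datum stays displayed exactly as in dag-n15-w5's theorem (my bump fits are named `o_χ, o_χ₁, o_χ₂` to keep their `o₀, o₁, o₂, oo`).  ★★★ `hasMaj_idef_smoothCutDressed_comp_commOp_cubeOp_out`.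

HONEST FRAMING ∕ LIMITS.  Pure instantiation; nothing of [B5]∕[B6]∕[B9] asserted ((1.120)–(1.128) pp.37–39, (2.91)–(2.92) p.239, (2.133)–(2.134) p.247, (3.52) p.400, (3.62)–(3.65)
pp.402–403, (3.76)–(3.77) pp.405–406, Thm 3.14 pp.426–427 = SHAPES ∕ MECHANISM ∕ TEMPLATE).  NE2⁺ NOT PRINTED, NOT proved; N15 NOT discharged; counts of record UNMOVED (typed 28∕28 · discharged
5∕27); one finite 𝕋⁴ at fixed ε — NOT infinite volume, NOT OS on ℝ⁴, NOT a mass gap, NOT Clay; R4 closes the conditional finite-𝕋⁴ rung `BalabanLadder.UV` only.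
-/

set_option autoImplicit false

noncomputable section
open scoped BigOperators
open Finset

namespace Summit.QuantumFields.YangMills.BalabanUVNodes.N15.CurvedSpecies

open Literature.MathematicalPhysics.QuantumFieldTheory.Balaban1983to89
open Literature.MathematicalPhysics.QuantumFieldTheory.Balaban1983to89.B11SectG (BlockNorm HasMaj RowSum)
open Literature.MathematicalPhysics.QuantumFieldTheory.Balaban1983to89.B6RandomWalk (Triangle254)
open Literature.MathematicalPhysics.QuantumFieldTheory.Balaban1983to89.T4EtaRateDefect (idef)
open Literature.MathematicalPhysics.QuantumFieldTheory.Balaban1983to89.T4EtaRateCoeffDefect (pull)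
open Literature.MathematicalPhysics.QuantumFieldTheory.Balaban1983to89.B6Prop26Gluing (mulOp mulOp_apply ind ind_nonneg)
open Summit.QuantumFields.YangMills.BalabanUVNodes.N15.MatrixSpecies (liftBlk liftMap liftEquiv liftEquiv_apply liftEquiv_symm_apply)
open Summit.QuantumFields.YangMills.BalabanUVNodes.N15.BackgroundLayer (fgrad bgrad fgradAdj stack projO blkPair liftPair unstackM bgPropV projO_none_comp_stack)
open Summit.QuantumFields.YangMills.BalabanUVNodes.N15.Gluing (commOp lapOp)

variable {X X' ι J : Type} [Fintype X] [Fintype X'] [DecidableEq X] [DecidableEq X'] [Fintype ι] [DecidableEq ι] [Fintype J] [DecidableEq J] {g : B6.Geometry}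
  (blk : X → g.Site) (π : X' → X) (τ : J → X ≃ X) (τ' : J → X' ≃ X') (n n' : ℝ) (C : X → Matrix ι ι ℝ) (C' : X' → Matrix ι ι ℝ) (A : J ⊕ J → X → Matrix ι ι ℝ)
  (A' : J ⊕ J → X' → Matrix ι ι ℝ) (hX : X → ℝ) (hX' : X' → ℝ) {σ cr : ℝ} {N NV : (X × ι → ℝ) →ₗ[ℝ] (X × ι → ℝ)} {N' NV' : (X' × ι → ℝ) →ₗ[ℝ] (X' × ι → ℝ)}
  {χX χtX ψX ψ₂X : X → ℝ} {χX' χtX' ψX' ψ₂X' : X' → ℝ} {S : Set g.Site} {β β₁ βQ βQ₁ ct m₀ m₁ mQ₀ mQ₁ oχ oχ₁ oχ₂ δ : ℝ}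

/-- ★★★ **FILE 58's `hDKL` ROW FOR THE DRESSED SMOOTH-CUT CUBE** — dag-n15-w5's `hasMaj_idef_dressedV_comp_commOp_cubeOp_out` at `G₀ := M_χ̃N_□`, `G₀′ := M_{χ̃′}N′_□`.  Data: both grids' bumps
(`|χ̃| ≤ 1`, `|∇^±χ̃| ≤ c̃`, insertions both ways, fits `o_χ, o_χ₁, o_χ₂` across `π`), input cut-offs `N = NM_ψ` with one-step margins `ψ₂`, FILE 63's LEFT cut rows (`β, β₁`) with defects
(`m₀, m₁`) and RIGHT cut rows of `N∘∇^±_μ`, `∇^±_νN∘∇^±_μ` (`β^Q, β^Q₁`) with defects (`m^Q₀, m^Q₁`) at both grids; then VERBATIM dag-n15-w5's partition letters and fits, species rows and fits,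
the perturbations `V̂ = V(C, A) + N_V∘pr₀`, `V̂′` (letter `R`, fit `o`), `β̄Rc_r² < 1`, the `W`-row defect `r_W` at the dressed smooth-cut pair, `[N_L, M_h]`'s letter∕defect, `N_V`'s letters∕defect
⟹ `𝔇(X′∘[Σ∇′*∇′ + W′ + N_L′ − 𝒱′, M_{h′}], X∘[Σ∇*∇ + W + N_L − 𝒱, M_h]) ≤ 1_S(y)·r₀ᴸ(β̄, β̄^Q, m̄, m̄^Q)·e^{−ρ₃d}` with dag-n15-w5's constant.
[cite: Balaban1984PropagatorsI, (1.120)–(1.128) pp.37–38, p.39 (adjoint representation); Balaban1984PropagatorsII, (2.91)–(2.92) p.239, (2.133)–(2.134) p.247 (shapes + mechanism); Balaban1985BackgroundPropagators, (3.52) p.400, (3.62)–(3.65) pp.402–403, (3.76)–(3.77) pp.405–406, Thm 3.14 pp.426–427 (template)] -/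
theorem hasMaj_idef_smoothCutDressed_comp_commOp_cubeOp_out (htri : Triangle254 g) (hd : ∀ a b : g.Site, 0 ≤ g.dist a b) (hsymm : ∀ y y', g.dist y y' = g.dist y' y)
    (hrow : RowSum g σ cr) (hσ : 0 ≤ σ) (hcr : 0 ≤ cr) {ρ₁ ρ₂ ρ₃ ρN δV δN ε R o c₀ c₁ c₂ o₀ o₁ o₂ oo rW rA oAt cN rN cV rV ℓ ω : ℝ}
    (hβ : 0 ≤ β) (hβ₁ : 0 ≤ β₁) (hβQ : 0 ≤ βQ) (hβQ₁ : 0 ≤ βQ₁) (hct : 0 ≤ ct) (hm₀ : 0 ≤ m₀) (hm₁ : 0 ≤ m₁) (hmQ₀ : 0 ≤ mQ₀) (hmQ₁ : 0 ≤ mQ₁) (hoχ : 0 ≤ oχ) (hoχ₁ : 0 ≤ oχ₁)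
    (hoχ₂ : 0 ≤ oχ₂) (hR : 0 ≤ R) (ho : 0 ≤ o) (hσρ : σ ≤ ρ₁) (hρ₁V : ρ₁ ≤ δV) (hρ₁G : ρ₁ + σ ≤ δ) (hρ₂ : 0 ≤ ρ₂) (hρ₂₁ : ρ₂ + σ ≤ ρ₁) (hρ₃ : 0 ≤ ρ₃) (hρ₃N : ρ₃ ≤ ρN)
    (hρ₃V : ρ₃ ≤ δN - ε) (hρ₃₂ : ρ₃ + σ ≤ ρ₂) (hε : 0 < ε) (hc₀ : 0 ≤ c₀) (hc₁ : 0 ≤ c₁) (hc₂ : 0 ≤ c₂) (ho₀ : 0 ≤ o₀) (ho₁ : 0 ≤ o₁) (ho₂ : 0 ≤ o₂) (hoo : 0 ≤ oo) (hrW : 0 ≤ rW)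
    (hrA : 0 ≤ rA) (hoAt : 0 ≤ oAt) (hcN : 0 ≤ cN) (hrN : 0 ≤ rN) (hcV : 0 ≤ cV) (hrV : 0 ≤ rV) (hℓ : 0 ≤ ℓ) (hω : 0 ≤ ω)
    (hSχ : ∀ x, χX x ≠ 0 → blk x ∈ S) (hSψ : ∀ x, ψX x ≠ 0 → blk x ∈ S) (hSψ₂ : ∀ x, ψ₂X x ≠ 0 → blk x ∈ S)
    (hSχ' : ∀ x', χX' x' ≠ 0 → blk (π x') ∈ S) (hSψ' : ∀ x', ψX' x' ≠ 0 → blk (π x') ∈ S) (hSψ₂' : ∀ x', ψ₂X' x' ≠ 0 → blk (π x') ∈ S)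
    (hmf : ∀ μ x, ψX x ≠ 0 → ψ₂X x = 1 ∧ ψ₂X (τ μ x) = 1) (hmb : ∀ μ x, ψX x ≠ 0 → ψ₂X x = 1 ∧ ψ₂X ((τ μ).symm x) = 1)
    (hmf' : ∀ μ x', ψX' x' ≠ 0 → ψ₂X' x' = 1 ∧ ψ₂X' (τ' μ x') = 1) (hmb' : ∀ μ x', ψX' x' ≠ 0 → ψ₂X' x' = 1 ∧ ψ₂X' ((τ' μ).symm x') = 1)
    -- coarse bump data
    (hχt : ∀ x, |χtX x| ≤ 1)
    (hdχt : ∀ μ p, |fgrad n (liftEquiv (τ μ) ι) (fun p : X × ι => χtX p.1) p| ≤ ct) (hdχtb : ∀ μ p, |bgrad n (liftEquiv (τ μ) ι) (fun p : X × ι => χtX p.1) p| ≤ ct)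
    (hsub : mulOp (fun p : X × ι => χtX p.1) ∘ₗ mulOp (fun p : X × ι => χX p.1) = mulOp (fun p : X × ι => χtX p.1))
    (hχ : mulOp (fun p : X × ι => χX p.1) ∘ₗ mulOp (fun p : X × ι => χtX p.1) = mulOp (fun p : X × ι => χtX p.1))
    (hs : ∀ μ, mulOp ((fun p : X × ι => χtX p.1) ∘ (liftEquiv (τ μ) ι)) ∘ₗ mulOp (fun p : X × ι => χX p.1) = mulOp ((fun p : X × ι => χtX p.1) ∘ (liftEquiv (τ μ) ι)))
    (hsb : ∀ μ, mulOp ((fun p : X × ι => χtX p.1) ∘ (liftEquiv (τ μ) ι).symm) ∘ₗ mulOp (fun p : X × ι => χX p.1) = mulOp ((fun p : X × ι => χtX p.1) ∘ (liftEquiv (τ μ) ι).symm))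
    (hdd : ∀ μ, mulOp (fgrad n (liftEquiv (τ μ) ι) (fun p : X × ι => χtX p.1)) ∘ₗ mulOp (fun p : X × ι => χX p.1) = mulOp (fgrad n (liftEquiv (τ μ) ι) (fun p : X × ι => χtX p.1)))
    (hddb : ∀ μ, mulOp (bgrad n (liftEquiv (τ μ) ι) (fun p : X × ι => χtX p.1)) ∘ₗ mulOp (fun p : X × ι => χX p.1) = mulOp (bgrad n (liftEquiv (τ μ) ι) (fun p : X × ι => χtX p.1)))
    (hNψ : N ∘ₗ mulOp (fun p : X × ι => ψX p.1) = N)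
    -- fine bump data
    (hχt' : ∀ x', |χtX' x'| ≤ 1)
    (hdχt' : ∀ μ p', |fgrad n' (liftEquiv (τ' μ) ι) (fun p' : X' × ι => χtX' p'.1) p'| ≤ ct) (hdχtb' : ∀ μ p', |bgrad n' (liftEquiv (τ' μ) ι) (fun p' : X' × ι => χtX' p'.1) p'| ≤ ct)
    (hsub' : mulOp (fun p : X' × ι => χtX' p.1) ∘ₗ mulOp (fun p : X' × ι => χX' p.1) = mulOp (fun p : X' × ι => χtX' p.1))
    (hχ' : mulOp (fun p : X' × ι => χX' p.1) ∘ₗ mulOp (fun p : X' × ι => χtX' p.1) = mulOp (fun p : X' × ι => χtX' p.1))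
    (hs' : ∀ μ, mulOp ((fun p' : X' × ι => χtX' p'.1) ∘ (liftEquiv (τ' μ) ι)) ∘ₗ mulOp (fun p' : X' × ι => χX' p'.1) = mulOp ((fun p' : X' × ι => χtX' p'.1) ∘ (liftEquiv (τ' μ) ι)))
    (hsb' : ∀ μ, mulOp ((fun p' : X' × ι => χtX' p'.1) ∘ (liftEquiv (τ' μ) ι).symm) ∘ₗ mulOp (fun p' : X' × ι => χX' p'.1) =
      mulOp ((fun p' : X' × ι => χtX' p'.1) ∘ (liftEquiv (τ' μ) ι).symm))
    (hdd' : ∀ μ, mulOp (fgrad n' (liftEquiv (τ' μ) ι) (fun p' : X' × ι => χtX' p'.1)) ∘ₗ mulOp (fun p' : X' × ι => χX' p'.1) = mulOp (fgrad n' (liftEquiv (τ' μ) ι) (fun p' : X' × ι => χtX' p'.1)))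
    (hddb' : ∀ μ, mulOp (bgrad n' (liftEquiv (τ' μ) ι) (fun p' : X' × ι => χtX' p'.1)) ∘ₗ mulOp (fun p' : X' × ι => χX' p'.1) = mulOp (bgrad n' (liftEquiv (τ' μ) ι) (fun p' : X' × ι => χtX' p'.1)))
    (hNψ' : N' ∘ₗ mulOp (fun p : X' × ι => ψX' p.1) = N')
    -- fits of the bumps across `π`
    (hfitχ : ∀ x', |χtX' x' - χtX (π x')| ≤ oχ)
    (hfit₁ : ∀ μ p', |((fun p' : X' × ι => χtX' p'.1) ∘ (liftEquiv (τ' μ) ι)) p' - ((fun p : X × ι => χtX p.1) ∘ (liftEquiv (τ μ) ι)) (liftMap π ι p')| ≤ oχ₁)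
    (hfit₁b : ∀ μ p', |((fun p' : X' × ι => χtX' p'.1) ∘ (liftEquiv (τ' μ) ι).symm) p' - ((fun p : X × ι => χtX p.1) ∘ (liftEquiv (τ μ) ι).symm) (liftMap π ι p')| ≤ oχ₁)
    (hfit₂ : ∀ μ p', |fgrad n' (liftEquiv (τ' μ) ι) (fun p' : X' × ι => χtX' p'.1) p' - fgrad n (liftEquiv (τ μ) ι) (fun p : X × ι => χtX p.1) (liftMap π ι p')| ≤ oχ₂)
    (hfit₂b : ∀ μ p', |bgrad n' (liftEquiv (τ' μ) ι) (fun p' : X' × ι => χtX' p'.1) p' - bgrad n (liftEquiv (τ μ) ι) (fun p : X × ι => χtX p.1) (liftMap π ι p')| ≤ oχ₂)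
    -- cut rows and their defects
    (hcut : HasMaj (BlockNorm.ofBlocks g (liftBlk blk ι)) (BlockNorm.ofBlocks g (liftBlk blk ι)) (mulOp (fun p : X × ι => χX p.1) ∘ₗ N)
      (fun y y' => ind S y * ind S y' * (β * Real.exp (-(δ * g.dist y y')))))
    (hcutF : ∀ μ, HasMaj (BlockNorm.ofBlocks g (liftBlk blk ι)) (BlockNorm.ofBlocks g (liftBlk blk ι)) (mulOp (fun p : X × ι => χX p.1) ∘ₗ (fgrad n (liftEquiv (τ μ) ι) ∘ₗ N))
      (fun y y' => ind S y * ind S y' * (β₁ * Real.exp (-(δ * g.dist y y')))))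
    (hcutB : ∀ μ, HasMaj (BlockNorm.ofBlocks g (liftBlk blk ι)) (BlockNorm.ofBlocks g (liftBlk blk ι)) (mulOp (fun p : X × ι => χX p.1) ∘ₗ (bgrad n (liftEquiv (τ μ) ι) ∘ₗ N))
      (fun y y' => ind S y * ind S y' * (β₁ * Real.exp (-(δ * g.dist y y')))))
    (hcut' : HasMaj (BlockNorm.ofBlocks g (liftBlk (blk ∘ π) ι)) (BlockNorm.ofBlocks g (liftBlk (blk ∘ π) ι)) (mulOp (fun p : X' × ι => χX' p.1) ∘ₗ N')
      (fun y y' => ind S y * ind S y' * (β * Real.exp (-(δ * g.dist y y')))))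
    (hcutF' : ∀ μ, HasMaj (BlockNorm.ofBlocks g (liftBlk (blk ∘ π) ι)) (BlockNorm.ofBlocks g (liftBlk (blk ∘ π) ι)) (mulOp (fun p : X' × ι => χX' p.1) ∘ₗ (fgrad n' (liftEquiv (τ' μ) ι) ∘ₗ N'))
      (fun y y' => ind S y * ind S y' * (β₁ * Real.exp (-(δ * g.dist y y')))))
    (hcutB' : ∀ μ, HasMaj (BlockNorm.ofBlocks g (liftBlk (blk ∘ π) ι)) (BlockNorm.ofBlocks g (liftBlk (blk ∘ π) ι)) (mulOp (fun p : X' × ι => χX' p.1) ∘ₗ (bgrad n' (liftEquiv (τ' μ) ι) ∘ₗ N'))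
      (fun y y' => ind S y * ind S y' * (β₁ * Real.exp (-(δ * g.dist y y')))))
    (hDcut : HasMaj (BlockNorm.ofBlocks g (liftBlk blk ι)) (BlockNorm.ofBlocks g (liftBlk blk ι ∘ liftMap π ι))
      (idef (pull (liftMap π ι)) (pull (liftMap π ι)) (mulOp (fun p : X' × ι => χX' p.1) ∘ₗ N') (mulOp (fun p : X × ι => χX p.1) ∘ₗ N))
      (fun y y' => ind S y * ind S y' * (m₀ * Real.exp (-(δ * g.dist y y')))))
    (hDcutF : ∀ μ, HasMaj (BlockNorm.ofBlocks g (liftBlk blk ι)) (BlockNorm.ofBlocks g (liftBlk blk ι ∘ liftMap π ι))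
      (idef (pull (liftMap π ι)) (pull (liftMap π ι)) (mulOp (fun p : X' × ι => χX' p.1) ∘ₗ (fgrad n' (liftEquiv (τ' μ) ι) ∘ₗ N')) (mulOp (fun p : X × ι => χX p.1) ∘ₗ (fgrad n (liftEquiv (τ μ) ι) ∘ₗ N)))
      (fun y y' => ind S y * ind S y' * (m₁ * Real.exp (-(δ * g.dist y y')))))
    (hDcutB : ∀ μ, HasMaj (BlockNorm.ofBlocks g (liftBlk blk ι)) (BlockNorm.ofBlocks g (liftBlk blk ι ∘ liftMap π ι))
      (idef (pull (liftMap π ι)) (pull (liftMap π ι)) (mulOp (fun p : X' × ι => χX' p.1) ∘ₗ (bgrad n' (liftEquiv (τ' μ) ι) ∘ₗ N')) (mulOp (fun p : X × ι => χX p.1) ∘ₗ (bgrad n (liftEquiv (τ μ) ι) ∘ₗ N)))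
      (fun y y' => ind S y * ind S y' * (m₁ * Real.exp (-(δ * g.dist y y')))))
    -- FILE 63's RIGHT cut rows of `N∘∇^±_μ`, `∇^±_νN∘∇^±_μ` at both grids (`β^Q, β^Q₁`) and their defects (`m^Q₀, m^Q₁`)
    (hcutQf : ∀ μ, HasMaj (BlockNorm.ofBlocks g (liftBlk blk ι)) (BlockNorm.ofBlocks g (liftBlk blk ι)) (mulOp (fun p : X × ι => χX p.1) ∘ₗ (N ∘ₗ fgrad n (liftEquiv (τ μ) ι))) (fun y y' => ind S y * ind S y' * (βQ * Real.exp (-(δ * g.dist y y')))))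
    (hcutQb : ∀ μ, HasMaj (BlockNorm.ofBlocks g (liftBlk blk ι)) (BlockNorm.ofBlocks g (liftBlk blk ι)) (mulOp (fun p : X × ι => χX p.1) ∘ₗ (N ∘ₗ bgrad n (liftEquiv (τ μ) ι))) (fun y y' => ind S y * ind S y' * (βQ * Real.exp (-(δ * g.dist y y')))))
    (hcutFQf : ∀ μ ν, HasMaj (BlockNorm.ofBlocks g (liftBlk blk ι)) (BlockNorm.ofBlocks g (liftBlk blk ι)) (mulOp (fun p : X × ι => χX p.1) ∘ₗ (fgrad n (liftEquiv (τ ν) ι) ∘ₗ (N ∘ₗ fgrad n (liftEquiv (τ μ) ι)))) (fun y y' => ind S y * ind S y' * (βQ₁ * Real.exp (-(δ * g.dist y y')))))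
    (hcutBQf : ∀ μ ν, HasMaj (BlockNorm.ofBlocks g (liftBlk blk ι)) (BlockNorm.ofBlocks g (liftBlk blk ι)) (mulOp (fun p : X × ι => χX p.1) ∘ₗ (bgrad n (liftEquiv (τ ν) ι) ∘ₗ (N ∘ₗ fgrad n (liftEquiv (τ μ) ι)))) (fun y y' => ind S y * ind S y' * (βQ₁ * Real.exp (-(δ * g.dist y y')))))
    (hcutFQb : ∀ μ ν, HasMaj (BlockNorm.ofBlocks g (liftBlk blk ι)) (BlockNorm.ofBlocks g (liftBlk blk ι)) (mulOp (fun p : X × ι => χX p.1) ∘ₗ (fgrad n (liftEquiv (τ ν) ι) ∘ₗ (N ∘ₗ bgrad n (liftEquiv (τ μ) ι)))) (fun y y' => ind S y * ind S y' * (βQ₁ * Real.exp (-(δ * g.dist y y')))))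
    (hcutBQb : ∀ μ ν, HasMaj (BlockNorm.ofBlocks g (liftBlk blk ι)) (BlockNorm.ofBlocks g (liftBlk blk ι)) (mulOp (fun p : X × ι => χX p.1) ∘ₗ (bgrad n (liftEquiv (τ ν) ι) ∘ₗ (N ∘ₗ bgrad n (liftEquiv (τ μ) ι)))) (fun y y' => ind S y * ind S y' * (βQ₁ * Real.exp (-(δ * g.dist y y')))))
    (hcutQf' : ∀ μ, HasMaj (BlockNorm.ofBlocks g (liftBlk (blk ∘ π) ι)) (BlockNorm.ofBlocks g (liftBlk (blk ∘ π) ι)) (mulOp (fun p : X' × ι => χX' p.1) ∘ₗ (N' ∘ₗ fgrad n' (liftEquiv (τ' μ) ι))) (fun y y' => ind S y * ind S y' * (βQ * Real.exp (-(δ * g.dist y y')))))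
    (hcutQb' : ∀ μ, HasMaj (BlockNorm.ofBlocks g (liftBlk (blk ∘ π) ι)) (BlockNorm.ofBlocks g (liftBlk (blk ∘ π) ι)) (mulOp (fun p : X' × ι => χX' p.1) ∘ₗ (N' ∘ₗ bgrad n' (liftEquiv (τ' μ) ι))) (fun y y' => ind S y * ind S y' * (βQ * Real.exp (-(δ * g.dist y y')))))
    (hcutFQf' : ∀ μ ν, HasMaj (BlockNorm.ofBlocks g (liftBlk (blk ∘ π) ι)) (BlockNorm.ofBlocks g (liftBlk (blk ∘ π) ι)) (mulOp (fun p : X' × ι => χX' p.1) ∘ₗ (fgrad n' (liftEquiv (τ' ν) ι) ∘ₗ (N' ∘ₗ fgrad n' (liftEquiv (τ' μ) ι)))) (fun y y' => ind S y * ind S y' * (βQ₁ * Real.exp (-(δ * g.dist y y')))))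
    (hcutBQf' : ∀ μ ν, HasMaj (BlockNorm.ofBlocks g (liftBlk (blk ∘ π) ι)) (BlockNorm.ofBlocks g (liftBlk (blk ∘ π) ι)) (mulOp (fun p : X' × ι => χX' p.1) ∘ₗ (bgrad n' (liftEquiv (τ' ν) ι) ∘ₗ (N' ∘ₗ fgrad n' (liftEquiv (τ' μ) ι)))) (fun y y' => ind S y * ind S y' * (βQ₁ * Real.exp (-(δ * g.dist y y')))))
    (hcutFQb' : ∀ μ ν, HasMaj (BlockNorm.ofBlocks g (liftBlk (blk ∘ π) ι)) (BlockNorm.ofBlocks g (liftBlk (blk ∘ π) ι)) (mulOp (fun p : X' × ι => χX' p.1) ∘ₗ (fgrad n' (liftEquiv (τ' ν) ι) ∘ₗ (N' ∘ₗ bgrad n' (liftEquiv (τ' μ) ι)))) (fun y y' => ind S y * ind S y' * (βQ₁ * Real.exp (-(δ * g.dist y y')))))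
    (hcutBQb' : ∀ μ ν, HasMaj (BlockNorm.ofBlocks g (liftBlk (blk ∘ π) ι)) (BlockNorm.ofBlocks g (liftBlk (blk ∘ π) ι)) (mulOp (fun p : X' × ι => χX' p.1) ∘ₗ (bgrad n' (liftEquiv (τ' ν) ι) ∘ₗ (N' ∘ₗ bgrad n' (liftEquiv (τ' μ) ι)))) (fun y y' => ind S y * ind S y' * (βQ₁ * Real.exp (-(δ * g.dist y y')))))
    (hDcutQf : ∀ μ, HasMaj (BlockNorm.ofBlocks g (liftBlk blk ι)) (BlockNorm.ofBlocks g (liftBlk blk ι ∘ liftMap π ι))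
      (idef (pull (liftMap π ι)) (pull (liftMap π ι)) (mulOp (fun p : X' × ι => χX' p.1) ∘ₗ (N' ∘ₗ fgrad n' (liftEquiv (τ' μ) ι))) (mulOp (fun p : X × ι => χX p.1) ∘ₗ (N ∘ₗ fgrad n (liftEquiv (τ μ) ι)))) (fun y y' => ind S y * ind S y' * (mQ₀ * Real.exp (-(δ * g.dist y y')))))
    (hDcutQb : ∀ μ, HasMaj (BlockNorm.ofBlocks g (liftBlk blk ι)) (BlockNorm.ofBlocks g (liftBlk blk ι ∘ liftMap π ι))
      (idef (pull (liftMap π ι)) (pull (liftMap π ι)) (mulOp (fun p : X' × ι => χX' p.1) ∘ₗ (N' ∘ₗ bgrad n' (liftEquiv (τ' μ) ι))) (mulOp (fun p : X × ι => χX p.1) ∘ₗ (N ∘ₗ bgrad n (liftEquiv (τ μ) ι)))) (fun y y' => ind S y * ind S y' * (mQ₀ * Real.exp (-(δ * g.dist y y')))))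
    (hDcutFQf : ∀ μ ν, HasMaj (BlockNorm.ofBlocks g (liftBlk blk ι)) (BlockNorm.ofBlocks g (liftBlk blk ι ∘ liftMap π ι))
      (idef (pull (liftMap π ι)) (pull (liftMap π ι)) (mulOp (fun p : X' × ι => χX' p.1) ∘ₗ (fgrad n' (liftEquiv (τ' ν) ι) ∘ₗ (N' ∘ₗ fgrad n' (liftEquiv (τ' μ) ι)))) (mulOp (fun p : X × ι => χX p.1) ∘ₗ (fgrad n (liftEquiv (τ ν) ι) ∘ₗ (N ∘ₗ fgrad n (liftEquiv (τ μ) ι))))) (fun y y' => ind S y * ind S y' * (mQ₁ * Real.exp (-(δ * g.dist y y')))))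
    (hDcutBQf : ∀ μ ν, HasMaj (BlockNorm.ofBlocks g (liftBlk blk ι)) (BlockNorm.ofBlocks g (liftBlk blk ι ∘ liftMap π ι))
      (idef (pull (liftMap π ι)) (pull (liftMap π ι)) (mulOp (fun p : X' × ι => χX' p.1) ∘ₗ (bgrad n' (liftEquiv (τ' ν) ι) ∘ₗ (N' ∘ₗ fgrad n' (liftEquiv (τ' μ) ι)))) (mulOp (fun p : X × ι => χX p.1) ∘ₗ (bgrad n (liftEquiv (τ ν) ι) ∘ₗ (N ∘ₗ fgrad n (liftEquiv (τ μ) ι))))) (fun y y' => ind S y * ind S y' * (mQ₁ * Real.exp (-(δ * g.dist y y')))))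
    (hDcutFQb : ∀ μ ν, HasMaj (BlockNorm.ofBlocks g (liftBlk blk ι)) (BlockNorm.ofBlocks g (liftBlk blk ι ∘ liftMap π ι))
      (idef (pull (liftMap π ι)) (pull (liftMap π ι)) (mulOp (fun p : X' × ι => χX' p.1) ∘ₗ (fgrad n' (liftEquiv (τ' ν) ι) ∘ₗ (N' ∘ₗ bgrad n' (liftEquiv (τ' μ) ι)))) (mulOp (fun p : X × ι => χX p.1) ∘ₗ (fgrad n (liftEquiv (τ ν) ι) ∘ₗ (N ∘ₗ bgrad n (liftEquiv (τ μ) ι))))) (fun y y' => ind S y * ind S y' * (mQ₁ * Real.exp (-(δ * g.dist y y')))))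
    (hDcutBQb : ∀ μ ν, HasMaj (BlockNorm.ofBlocks g (liftBlk blk ι)) (BlockNorm.ofBlocks g (liftBlk blk ι ∘ liftMap π ι))
      (idef (pull (liftMap π ι)) (pull (liftMap π ι)) (mulOp (fun p : X' × ι => χX' p.1) ∘ₗ (bgrad n' (liftEquiv (τ' ν) ι) ∘ₗ (N' ∘ₗ bgrad n' (liftEquiv (τ' μ) ι)))) (mulOp (fun p : X × ι => χX p.1) ∘ₗ (bgrad n (liftEquiv (τ ν) ι) ∘ₗ (N ∘ₗ bgrad n (liftEquiv (τ μ) ι))))) (fun y y' => ind S y * ind S y' * (mQ₁ * Real.exp (-(δ * g.dist y y')))))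
    {W NL : (X × ι → ℝ) →ₗ[ℝ] (X × ι → ℝ)} {W' NL' : (X' × ι → ℝ) →ₗ[ℝ] (X' × ι → ℝ)} {hb : g.Site → ℝ}
    -- the partition: vector-carrier letters `c₁, c₂` and the five translated fits (the flat half)
    (hh1v : ∀ μ p, |fgrad n (liftEquiv (τ μ) ι) (fun p : X × ι => hX p.1) p| ≤ c₁) (hh1bv : ∀ μ p, |bgrad n (liftEquiv (τ μ) ι) (fun p : X × ι => hX p.1) p| ≤ c₁)
    (hh2 : ∀ μ p, |fgradAdj n (liftEquiv (τ μ) ι) (fgrad n (liftEquiv (τ μ) ι) (fun p : X × ι => hX p.1)) p| ≤ c₂)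
    (hh2f : ∀ μ p, |fgrad n (liftEquiv (τ μ) ι) (fgrad n (liftEquiv (τ μ) ι) (fun p : X × ι => hX p.1)) p| ≤ c₂)
    (hh2b : ∀ μ p, |bgrad n (liftEquiv (τ μ) ι) (bgrad n (liftEquiv (τ μ) ι) (fun p : X × ι => hX p.1) ∘ ⇑(liftEquiv (τ μ) ι)) p| ≤ c₂)
    (hF0 : ∀ μ p', |fgradAdj n' (liftEquiv (τ' μ) ι) (fgrad n' (liftEquiv (τ' μ) ι) (fun p' : X' × ι => hX' p'.1)) p' -
      fgradAdj n (liftEquiv (τ μ) ι) (fgrad n (liftEquiv (τ μ) ι) (fun p : X × ι => hX p.1)) (liftMap π ι p')| ≤ o₂)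
    (hF1 : ∀ μ p', |fgrad n' (liftEquiv (τ' μ) ι) (fun p' : X' × ι => hX' p'.1) ((liftEquiv (τ' μ) ι).symm p') -
      fgrad n (liftEquiv (τ μ) ι) (fun p : X × ι => hX p.1) ((liftEquiv (τ μ) ι).symm (liftMap π ι p'))| ≤ o₁)
    (hF2 : ∀ μ p', |fgrad n' (liftEquiv (τ' μ) ι) (fgrad n' (liftEquiv (τ' μ) ι) (fun p' : X' × ι => hX' p'.1)) ((liftEquiv (τ' μ) ι).symm p') -
      fgrad n (liftEquiv (τ μ) ι) (fgrad n (liftEquiv (τ μ) ι) (fun p : X × ι => hX p.1)) ((liftEquiv (τ μ) ι).symm (liftMap π ι p'))| ≤ o₂)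
    (hF3 : ∀ μ p', |bgrad n' (liftEquiv (τ' μ) ι) (fun p' : X' × ι => hX' p'.1) (liftEquiv (τ' μ) ι p') -
      bgrad n (liftEquiv (τ μ) ι) (fun p : X × ι => hX p.1) (liftEquiv (τ μ) ι (liftMap π ι p'))| ≤ o₁)
    (hF4 : ∀ μ p', |bgrad n' (liftEquiv (τ' μ) ι) (bgrad n' (liftEquiv (τ' μ) ι) (fun p' : X' × ι => hX' p'.1) ∘ ⇑(liftEquiv (τ' μ) ι)) p' -
      bgrad n (liftEquiv (τ μ) ι) (bgrad n (liftEquiv (τ μ) ι) (fun p : X × ι => hX p.1) ∘ ⇑(liftEquiv (τ μ) ι)) (liftMap π ι p')| ≤ o₂)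
    -- the partition: scalar letters at both grids, plain fits, block-constant comparison (the dressed perturbation's half)
    (hh1 : ∀ μ x, |fgrad n (τ μ) hX x| ≤ c₁) (hh1b : ∀ μ x, |bgrad n (τ μ) hX x| ≤ c₁) (hh0 : ∀ μ x, |hX (τ μ x) - hX x| ≤ c₀)
    (hh1' : ∀ μ x', |fgrad n' (τ' μ) hX' x'| ≤ c₁) (hh1b' : ∀ μ x', |bgrad n' (τ' μ) hX' x'| ≤ c₁) (hh0' : ∀ μ x', |hX' (τ' μ x') - hX' x'| ≤ c₀)
    (hf1 : ∀ μ x', |fgrad n' (τ' μ) hX' x' - fgrad n (τ μ) hX (π x')| ≤ o₁) (hf1b : ∀ μ x', |bgrad n' (τ' μ) hX' x' - bgrad n (τ μ) hX (π x')| ≤ o₁)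
    (hf0 : ∀ μ x', |(hX' (τ' μ x') - hX' x') - (hX (τ μ (π x')) - hX (π x'))| ≤ o₀)
    (hf0b : ∀ μ x', |(hX' x' - hX' ((τ' μ).symm x')) - (hX (π x') - hX ((τ μ).symm (π x')))| ≤ o₀)
    (hfit : ∀ x', |hX' x' - hX (π x')| ≤ oo) (hLip : ∀ y y', |hb y - hb y'| ≤ ℓ * g.dist y y') (hrh : ∀ x, |hX x - hb (blk x)| ≤ ω) (hrh' : ∀ x', |hX' x' - hb (blk (π x'))| ≤ ω)
    -- the species rows and translated fits
    (hA : ∀ j x i, ∑ k, |A j x i k| ≤ rA)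
    (hfAb : ∀ μ x' i, ∑ k, |A' (Sum.inl μ) ((τ' μ).symm x') i k - A (Sum.inl μ) ((τ μ).symm (π x')) i k| ≤ oAt)
    (hfAf : ∀ μ x' i, ∑ k, |A' (Sum.inr μ) (τ' μ x') i k - A (Sum.inr μ) (τ μ (π x')) i k| ≤ oAt)
    -- the perturbations' letters and fit, smallness
    (hV : HasMaj (BlockNorm.ofBlocks g (blkPair (liftBlk blk ι))) (BlockNorm.ofBlocks g (liftBlk blk ι)) (unstackM C A + NV ∘ₗ projO (none : Option (J ⊕ J)))
      (fun y y' => R * Real.exp (-(δV * g.dist y y'))))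
    (hV' : HasMaj (BlockNorm.ofBlocks g (blkPair (liftBlk (blk ∘ π) ι))) (BlockNorm.ofBlocks g (liftBlk (blk ∘ π) ι)) (unstackM C' A' + NV' ∘ₗ projO (none : Option (J ⊕ J)))
      (fun y y' => R * Real.exp (-(δV * g.dist y y'))))
    (hDV : HasMaj (BlockNorm.ofBlocks g (blkPair (liftBlk blk ι))) (BlockNorm.ofBlocks g (liftBlk (blk ∘ π) ι))
      (idef (pull (liftPair (liftMap π ι))) (pull (liftMap π ι)) (unstackM C' A' + NV' ∘ₗ projO (none : Option (J ⊕ J))) (unstackM C A + NV ∘ₗ projO (none : Option (J ⊕ J))))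
      (fun y y' => o * Real.exp (-(δV * g.dist y y'))))
    (hq : (β + (β₁ + ct * β)) * (R * cr) * cr < 1)
    -- the `W`-row's defect at the dressed smooth-cut pair, the flat nonlocal summand's commutator letter and defect, the base perturbation's letters and defect
    (hDW : HasMaj (BlockNorm.ofBlocks g (liftBlk blk ι)) (BlockNorm.ofBlocks g (liftBlk (blk ∘ π) ι))
      (idef (pull (liftMap π ι)) (pull (liftMap π ι)) ((projO none ∘ₗ bgPropV (stack (mulOp (fun p : X' × ι => χtX' p.1) ∘ₗ N')
        (fun j => Sum.elim (fun μ => fgrad n' (liftEquiv (τ' μ) ι)) (fun μ => bgrad n' (liftEquiv (τ' μ) ι)) j ∘ₗ (mulOp (fun p : X' × ι => χtX' p.1) ∘ₗ N'))) (unstackM C' A' + NV' ∘ₗ projO (none : Option (J ⊕ J)))) ∘ₗ commOp W' (fun p' : X' × ι => hX' p'.1))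
        ((projO none ∘ₗ bgPropV (stack (mulOp (fun p : X × ι => χtX p.1) ∘ₗ N)
        (fun j => Sum.elim (fun μ => fgrad n (liftEquiv (τ μ) ι)) (fun μ => bgrad n (liftEquiv (τ μ) ι)) j ∘ₗ (mulOp (fun p : X × ι => χtX p.1) ∘ₗ N))) (unstackM C A + NV ∘ₗ projO (none : Option (J ⊕ J)))) ∘ₗ commOp W (fun p : X × ι => hX p.1)))
      (fun y y' => ind S y * ind S y' * (rW * Real.exp (-(ρ₂ * g.dist y y')))))
    (hKN : HasMaj (BlockNorm.ofBlocks g (liftBlk blk ι)) (BlockNorm.ofBlocks g (liftBlk blk ι)) (commOp NL (fun p : X × ι => hX p.1)) (fun y y' => cN * Real.exp (-(ρN * g.dist y y'))))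
    (hDKN : HasMaj (BlockNorm.ofBlocks g (liftBlk blk ι)) (BlockNorm.ofBlocks g (liftBlk (blk ∘ π) ι))
      (idef (pull (liftMap π ι)) (pull (liftMap π ι)) (commOp NL' (fun p' : X' × ι => hX' p'.1)) (commOp NL (fun p : X × ι => hX p.1))) (fun y y' => rN * Real.exp (-(ρN * g.dist y y'))))
    (hNV : HasMaj (BlockNorm.ofBlocks g (liftBlk blk ι)) (BlockNorm.ofBlocks g (liftBlk blk ι)) NV (fun y y' => cV * Real.exp (-(δN * g.dist y y'))))
    (hNV' : HasMaj (BlockNorm.ofBlocks g (liftBlk (blk ∘ π) ι)) (BlockNorm.ofBlocks g (liftBlk (blk ∘ π) ι)) NV' (fun y y' => cV * Real.exp (-(δN * g.dist y y'))))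
    (hDNV : HasMaj (BlockNorm.ofBlocks g (liftBlk blk ι)) (BlockNorm.ofBlocks g (liftBlk (blk ∘ π) ι)) (idef (pull (liftMap π ι)) (pull (liftMap π ι)) NV' NV)
      (fun y y' => rV * Real.exp (-(δN * g.dist y y')))) :
    HasMaj (BlockNorm.ofBlocks g (liftBlk blk ι)) (BlockNorm.ofBlocks g (liftBlk (blk ∘ π) ι))
      (idef (pull (liftMap π ι)) (pull (liftMap π ι))
        ((projO none ∘ₗ bgPropV (stack (mulOp (fun p : X' × ι => χtX' p.1) ∘ₗ N')
        (fun j => Sum.elim (fun μ => fgrad n' (liftEquiv (τ' μ) ι)) (fun μ => bgrad n' (liftEquiv (τ' μ) ι)) j ∘ₗ (mulOp (fun p : X' × ι => χtX' p.1) ∘ₗ N'))) (unstackM C' A' + NV' ∘ₗ projO (none : Option (J ⊕ J)))) ∘ₗ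
          commOp (lapOp n' (fun μ => liftEquiv (τ' μ) ι) W' + NL' - (unstackM C' A' + NV' ∘ₗ projO (none : Option (J ⊕ J))) ∘ₗ
            stack LinearMap.id (fun j => Sum.elim (fun μ => fgrad n' (liftEquiv (τ' μ) ι)) (fun μ => bgrad n' (liftEquiv (τ' μ) ι)) j)) (fun p' : X' × ι => hX' p'.1))
        ((projO none ∘ₗ bgPropV (stack (mulOp (fun p : X × ι => χtX p.1) ∘ₗ N)
        (fun j => Sum.elim (fun μ => fgrad n (liftEquiv (τ μ) ι)) (fun μ => bgrad n (liftEquiv (τ μ) ι)) j ∘ₗ (mulOp (fun p : X × ι => χtX p.1) ∘ₗ N))) (unstackM C A + NV ∘ₗ projO (none : Option (J ⊕ J)))) ∘ₗ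
          commOp (lapOp n (fun μ => liftEquiv (τ μ) ι) W + NL - (unstackM C A + NV ∘ₗ projO (none : Option (J ⊕ J))) ∘ₗ
            stack LinearMap.id (fun j => Sum.elim (fun μ => fgrad n (liftEquiv (τ μ) ι)) (fun μ => bgrad n (liftEquiv (τ μ) ι)) j)) (fun p : X × ι => hX p.1)))
      (fun y y' => ind S y * (
        (((Fintype.card J * (3 * ((β + (β₁ + ct * β)) * (1 - (β + (β₁ + ct * β)) * (R * cr) * cr)⁻¹ * o₂ + (((m₀ + oχ * β) + (m₁ + oχ₁ * β₁ + ct * m₀ + oχ₂ * β)) * cr + 1 * (((m₀ + oχ * β) + (m₁ + oχ₁ * β₁ + ct * m₀ + oχ₂ * β)) * cr) * (R * ((β + (β₁ + ct * β)) * (1 - (β + (β₁ + ct * β)) * (R * cr) * cr)⁻¹) * cr) + (β + (β₁ + ct * β)) * o * cr * ((β + (β₁ + ct * β)) * (1 - (β + (β₁ + ct * β)) * (R * cr) * cr)⁻¹) * cr) * (1 - 1 * ((β + (β₁ + ct * β)) * (R * cr) * cr))⁻¹ * c₂) + 2 * ((βQ + (βQ₁ + ct * βQ)) * (1 - (β +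 (β₁ + ct * β)) * (R * cr) * cr)⁻¹ * o₁ + (((mQ₀ + oχ * βQ) + (mQ₁ + oχ₁ * βQ₁ + ct * mQ₀ + oχ₂ * βQ)) * cr + ((m₀ + oχ * β) + (m₁ + oχ₁ * β₁ + ct * m₀ + oχ₂ * β)) * cr * (R * ((βQ + (βQ₁ + ct * βQ)) * (1 - (β + (β₁ + ct * β)) * (R * cr) * cr)⁻¹) * cr) + (β + (β₁ + ct * β)) * o * cr * ((βQ + (βQ₁ + ct * βQ)) * (1 - (β + (β₁ + ct * β)) * (R * cr) * cr)⁻¹) * cr) * (1 - (β + (β₁ + ct * β)) * (R * cr) * cr)⁻¹ * c₁)) + rW) + ((β + (β₁ + ct * β)) * (1 - (β + (β₁ + ct * β)) * (R * cr) * cr)⁻¹) * rN * cr + ((((m₀ + oχ * β) + (m₁ + oχ₁ * β₁ + ct * m₀ + oχ₂ * β)) * cr + 1 * (((m₀ + oχ * β) + (m₁ + oχ₁ * β₁ + ct * m₀ + oχ₂ * β)) * cr) * (R * ((β + (β₁ + ct * β)) * (1 - (β + (β₁ + ct * β)) * (R * cr) * cr)⁻¹) * cr) + (β + (β₁ + ct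 * β)) * o * cr * ((β + (β₁ + ct * β)) * (1 - (β + (β₁ + ct * β)) * (R * cr) * cr)⁻¹) * cr) * (1 - 1 * ((β + (β₁ + ct * β)) * (R * cr) * cr))⁻¹) * cN * cr)
        + ((Fintype.card J * (2 * (rA * (c₁ * ((((m₀ + oχ * β) + (m₁ + oχ₁ * β₁ + ct * m₀ + oχ₂ * β)) * cr + 1 * (((m₀ + oχ * β) + (m₁ + oχ₁ * β₁ + ct * m₀ + oχ₂ * β)) * cr) * (R * ((β + (β₁ + ct * β)) * (1 - (β + (β₁ + ct * β)) * (R * cr) * cr)⁻¹) * cr) + (β + (β₁ + ct * β)) * o * cr * ((β + (β₁ + ct * β)) * (1 - (β + (β₁ + ct * β)) * (R * cr) * cr)⁻¹) * cr) * (1 - 1 * ((β + (β₁ + ct * β)) * (R * cr) * cr))⁻¹) + o₁ * ((β + (β₁ + ct * β)) * (1 - (β + (β₁ + ct * β)) * (R * cr) * cr)⁻¹) + c₀ * ((((mQ₀ + oχ * βQ) + (mQ₁ + oχ₁ * βQ₁ + ct * mQ₀ + oχ₂ * βQ)) * cr + ((m₀ + oχ * β) + (m₁ + oχ₁ * β₁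 + ct * m₀ + oχ₂ * β)) * cr * (R * ((βQ + (βQ₁ + ct * βQ)) * (1 - (β + (β₁ + ct * β)) * (R * cr) * cr)⁻¹) * cr) + (β + (β₁ + ct * β)) * o * cr * ((βQ + (βQ₁ + ct * βQ)) * (1 - (β + (β₁ + ct * β)) * (R * cr) * cr)⁻¹) * cr) * (1 - (β + (β₁ + ct * β)) * (R * cr) * cr)⁻¹) + o₀ * ((βQ + (βQ₁ + ct * βQ)) * (1 - (β + (β₁ + ct * β)) * (R * cr) * cr)⁻¹)) + oAt * (c₁ * ((β + (β₁ + ct * β)) * (1 - (β + (β₁ + ct * β)) * (R * cr) * cr)⁻¹) + c₀ * ((βQ + (βQ₁ + ct * βQ)) * (1 - (β + (β₁ + ct * β)) * (R * cr) * cr)⁻¹)))))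
          + ((β + (β₁ + ct * β)) * (1 - (β + (β₁ + ct * β)) * (R * cr) * cr)⁻¹) * (((ℓ * (Real.exp 1 * ε)⁻¹ + 2 * ω) * rV + 2 * oo * cV)) * cr + ((((m₀ + oχ * β) + (m₁ + oχ₁ * β₁ + ct * m₀ + oχ₂ * β)) * cr + 1 * (((m₀ + oχ * β) + (m₁ + oχ₁ * β₁ + ct * m₀ + oχ₂ * β)) * cr) * (R * ((β + (β₁ + ct * β)) * (1 - (β + (β₁ + ct * β)) * (R * cr) * cr)⁻¹) * cr) + (β + (β₁ + ct * β)) * o * cr * ((β + (β₁ + ct * β)) * (1 - (β + (β₁ + ct * β)) * (R * cr) * cr)⁻¹) * cr) * (1 - 1 * ((β + (β₁ + ct * β)) * (R * cr) * cr))⁻¹) * ((ℓ * (Real.exp 1 * ε)⁻¹ + 2 * ω) * cV) * cr))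
        * Real.exp (-(ρ₃ * g.dist y y')))) := by
  have hβb : 0 ≤ (β + (β₁ + ct * β)) := by positivity
  have hβQb : 0 ≤ (βQ + (βQ₁ + ct * βQ)) := by positivity
  have hmGb : 0 ≤ ((m₀ + oχ * β) + (m₁ + oχ₁ * β₁ + ct * m₀ + oχ₂ * β)) := by positivity
  have hmQGb : 0 ≤ ((mQ₀ + oχ * βQ) + (mQ₁ + oχ₁ * βQ₁ + ct * mQ₀ + oχ₂ * βQ)) := by positivity
  -- files 34∕35: both grids' flat entries and jets, and their defects
  have hG := hasMaj_smoothCut_flat blk (S := S) hβ hβ₁ hct hχt hsub hcut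
  have hD := hasMaj_jet_smoothCut_flat blk τ n (S := S) hβ hβ₁ hct hχt hdχt hdχtb hs hsb hdd hddb hcut hcutF hcutB
  have hG' := hasMaj_smoothCut_flat (blk ∘ π) (S := S) hβ hβ₁ hct hχt' hsub' hcut'
  have hD' := hasMaj_jet_smoothCut_flat (blk ∘ π) τ' n' (S := S) hβ hβ₁ hct hχt' hdχt' hdχtb' hs' hsb' hdd' hddb' hcut' hcutF' hcutB'
  have hDG := hasMaj_idef_smoothCut_flat blk π (S := S) (N := N) (N' := N') hβ hβ₁ hct hm₀ hm₁ hoχ hoχ₁ hoχ₂ hχt' hfitχ hsub hsub' hcut hDcut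
  have hDD := hasMaj_idef_jet_smoothCut_flat blk π τ τ' n n' (S := S) (N := N) (N' := N') hβ hβ₁ hct hm₀ hm₁ hoχ hoχ₁ hoχ₂ hχt' hdχt' hdχtb' hfit₁ hfit₁b hfit₂ hfit₂b hs hsb hdd hddb
    hs' hsb' hdd' hddb' hcut hcutF hcutB hDcut hDcutF hDcutB
  -- the flat RIGHT entries at both grids and their defects, at `N := N∘∇^±_μ` (files 34∕35)
  have hGQf : ∀ μ, HasMaj (BlockNorm.ofBlocks g (liftBlk blk ι)) (BlockNorm.ofBlocks g (liftBlk blk ι)) ((mulOp (fun p : X × ι => χtX p.1) ∘ₗ N) ∘ₗ fgrad n (liftEquiv (τ μ) ι)) (fun y y' => (βQ + (βQ₁ + ct * βQ)) * Real.exp (-(δ * g.dist y y'))) := fun μ => by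
    rw [LinearMap.comp_assoc]; exact hasMaj_smoothCut_flat blk (S := S) hβQ hβQ₁ hct hχt hsub (hcutQf μ)
  have hGQf' : ∀ μ, HasMaj (BlockNorm.ofBlocks g (liftBlk (blk ∘ π) ι)) (BlockNorm.ofBlocks g (liftBlk (blk ∘ π) ι)) ((mulOp (fun p : X' × ι => χtX' p.1) ∘ₗ N') ∘ₗ fgrad n' (liftEquiv (τ' μ) ι)) (fun y y' => (βQ + (βQ₁ + ct * βQ)) * Real.exp (-(δ * g.dist y y'))) := fun μ => by
    rw [LinearMap.comp_assoc]; exact hasMaj_smoothCut_flat (blk ∘ π) (S := S) hβQ hβQ₁ hct hχt' hsub' (hcutQf' μ)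
  have hDQf : ∀ μ (j : J ⊕ J), HasMaj (BlockNorm.ofBlocks g (liftBlk blk ι)) (BlockNorm.ofBlocks g (liftBlk blk ι)) ((Sum.elim (fun μ => fgrad n (liftEquiv (τ μ) ι)) (fun μ => bgrad n (liftEquiv (τ μ) ι)) j ∘ₗ (mulOp (fun p : X × ι => χtX p.1) ∘ₗ N)) ∘ₗ fgrad n (liftEquiv (τ μ) ι)) (fun y y' => (βQ + (βQ₁ + ct * βQ)) * Real.exp (-(δ * g.dist y y'))) := fun μ j => by
    rw [LinearMap.comp_assoc, LinearMap.comp_assoc]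
    exact hasMaj_jet_smoothCut_flat blk τ n (S := S) hβQ hβQ₁ hct hχt hdχt hdχtb hs hsb hdd hddb (hcutQf μ) (hcutFQf μ) (hcutBQf μ) j
  have hDQf' : ∀ μ (j : J ⊕ J), HasMaj (BlockNorm.ofBlocks g (liftBlk (blk ∘ π) ι)) (BlockNorm.ofBlocks g (liftBlk (blk ∘ π) ι)) ((Sum.elim (fun μ => fgrad n' (liftEquiv (τ' μ) ι)) (fun μ => bgrad n' (liftEquiv (τ' μ) ι)) j ∘ₗ (mulOp (fun p : X' × ι => χtX' p.1) ∘ₗ N')) ∘ₗ fgrad n' (liftEquiv (τ' μ) ι)) (fun y y' => (βQ + (βQ₁ + ct * βQ)) * Real.exp (-(δ * g.dist y y'))) := fun μ j => by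
    rw [LinearMap.comp_assoc, LinearMap.comp_assoc]
    exact hasMaj_jet_smoothCut_flat (blk ∘ π) τ' n' (S := S) hβQ hβQ₁ hct hχt' hdχt' hdχtb' hs' hsb' hdd' hddb' (hcutQf' μ) (hcutFQf' μ) (hcutBQf' μ) j
  have hDGQf : ∀ μ, HasMaj (BlockNorm.ofBlocks g (liftBlk blk ι)) (BlockNorm.ofBlocks g (liftBlk (blk ∘ π) ι)) (idef (pull (liftMap π ι)) (pull (liftMap π ι)) ((mulOp (fun p : X' × ι => χtX' p.1) ∘ₗ N') ∘ₗ fgrad n' (liftEquiv (τ' μ) ι)) ((mulOp (fun p : X × ι => χtX p.1) ∘ₗ N) ∘ₗ fgrad n (liftEquiv (τ μ) ι))) (fun y y' => ((mQ₀ + oχ * βQ) + (mQ₁ + oχ₁ * βQ₁ + ct * mQ₀ + oχ₂ * βQ)) * Real.exp (-(δ * g.dist y y'))) := fun μ => by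
    rw [LinearMap.comp_assoc, LinearMap.comp_assoc]
    exact hasMaj_idef_smoothCut_flat blk π (S := S) (N := N ∘ₗ fgrad n (liftEquiv (τ μ) ι)) (N' := N' ∘ₗ fgrad n' (liftEquiv (τ' μ) ι)) hβQ hβQ₁ hct hmQ₀ hmQ₁ hoχ hoχ₁ hoχ₂ hχt' hfitχ hsub hsub' (hcutQf μ) (hDcutQf μ)
  have hDDQf : ∀ μ (j : J ⊕ J), HasMaj (BlockNorm.ofBlocks g (liftBlk blk ι)) (BlockNorm.ofBlocks g (liftBlk (blk ∘ π) ι))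
      (idef (pull (liftMap π ι)) (pull (liftMap π ι)) ((Sum.elim (fun μ => fgrad n' (liftEquiv (τ' μ) ι)) (fun μ => bgrad n' (liftEquiv (τ' μ) ι)) j ∘ₗ (mulOp (fun p : X' × ι => χtX' p.1) ∘ₗ N')) ∘ₗ fgrad n' (liftEquiv (τ' μ) ι)) ((Sum.elim (fun μ => fgrad n (liftEquiv (τ μ) ι)) (fun μ => bgrad n (liftEquiv (τ μ) ι)) j ∘ₗ (mulOp (fun p : X × ι => χtX p.1) ∘ₗ N)) ∘ₗ fgrad n (liftEquiv (τ μ) ι))) (fun y y' => ((mQ₀ + oχ * βQ) + (mQ₁ + oχ₁ * βQ₁ + ct * mQ₀ + oχ₂ * βQ)) * Real.exp (-(δ * g.dist y y'))) := fun μ j => by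
    rw [LinearMap.comp_assoc, LinearMap.comp_assoc, LinearMap.comp_assoc, LinearMap.comp_assoc]
    exact hasMaj_idef_jet_smoothCut_flat blk π τ τ' n n' (S := S) (N := N ∘ₗ fgrad n (liftEquiv (τ μ) ι)) (N' := N' ∘ₗ fgrad n' (liftEquiv (τ' μ) ι)) hβQ hβQ₁ hct hmQ₀ hmQ₁ hoχ hoχ₁ hoχ₂ hχt' hdχt' hdχtb' hfit₁ hfit₁b hfit₂ hfit₂b
      hs hsb hdd hddb hs' hsb' hdd' hddb' (hcutQf μ) (hcutFQf μ) (hcutBQf μ) (hDcutQf μ) (hDcutFQf μ) (hDcutBQf μ) j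
  have hGQb : ∀ μ, HasMaj (BlockNorm.ofBlocks g (liftBlk blk ι)) (BlockNorm.ofBlocks g (liftBlk blk ι)) ((mulOp (fun p : X × ι => χtX p.1) ∘ₗ N) ∘ₗ bgrad n (liftEquiv (τ μ) ι)) (fun y y' => (βQ + (βQ₁ + ct * βQ)) * Real.exp (-(δ * g.dist y y'))) := fun μ => by
    rw [LinearMap.comp_assoc]; exact hasMaj_smoothCut_flat blk (S := S) hβQ hβQ₁ hct hχt hsub (hcutQb μ)
  have hGQb' : ∀ μ, HasMaj (BlockNorm.ofBlocks g (liftBlk (blk ∘ π) ι)) (BlockNorm.ofBlocks g (liftBlk (blk ∘ π) ι)) ((mulOp (fun p : X' × ι => χtX' p.1) ∘ₗ N') ∘ₗ bgrad n' (liftEquiv (τ' μ) ι)) (fun y y' => (βQ + (βQ₁ + ct * βQ)) * Real.exp (-(δ * g.dist y y'))) := fun μ => by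
    rw [LinearMap.comp_assoc]; exact hasMaj_smoothCut_flat (blk ∘ π) (S := S) hβQ hβQ₁ hct hχt' hsub' (hcutQb' μ)
  have hDQb : ∀ μ (j : J ⊕ J), HasMaj (BlockNorm.ofBlocks g (liftBlk blk ι)) (BlockNorm.ofBlocks g (liftBlk blk ι)) ((Sum.elim (fun μ => fgrad n (liftEquiv (τ μ) ι)) (fun μ => bgrad n (liftEquiv (τ μ) ι)) j ∘ₗ (mulOp (fun p : X × ι => χtX p.1) ∘ₗ N)) ∘ₗ bgrad n (liftEquiv (τ μ) ι)) (fun y y' => (βQ + (βQ₁ + ct * βQ)) * Real.exp (-(δ * g.dist y y'))) := fun μ j => by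
    rw [LinearMap.comp_assoc, LinearMap.comp_assoc]
    exact hasMaj_jet_smoothCut_flat blk τ n (S := S) hβQ hβQ₁ hct hχt hdχt hdχtb hs hsb hdd hddb (hcutQb μ) (hcutFQb μ) (hcutBQb μ) j
  have hDQb' : ∀ μ (j : J ⊕ J), HasMaj (BlockNorm.ofBlocks g (liftBlk (blk ∘ π) ι)) (BlockNorm.ofBlocks g (liftBlk (blk ∘ π) ι)) ((Sum.elim (fun μ => fgrad n' (liftEquiv (τ' μ) ι)) (fun μ => bgrad n' (liftEquiv (τ' μ) ι)) j ∘ₗ (mulOp (fun p : X' × ι => χtX' p.1) ∘ₗ N')) ∘ₗ bgrad n' (liftEquiv (τ' μ) ι)) (fun y y' => (βQ + (βQ₁ + ct * βQ)) * Real.exp (-(δ * g.dist y y'))) := fun μ j => by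
    rw [LinearMap.comp_assoc, LinearMap.comp_assoc]
    exact hasMaj_jet_smoothCut_flat (blk ∘ π) τ' n' (S := S) hβQ hβQ₁ hct hχt' hdχt' hdχtb' hs' hsb' hdd' hddb' (hcutQb' μ) (hcutFQb' μ) (hcutBQb' μ) j
  have hDGQb : ∀ μ, HasMaj (BlockNorm.ofBlocks g (liftBlk blk ι)) (BlockNorm.ofBlocks g (liftBlk (blk ∘ π) ι)) (idef (pull (liftMap π ι)) (pull (liftMap π ι)) ((mulOp (fun p : X' × ι => χtX' p.1) ∘ₗ N') ∘ₗ bgrad n' (liftEquiv (τ' μ) ι)) ((mulOp (fun p : X × ι => χtX p.1) ∘ₗ N) ∘ₗ bgrad n (liftEquiv (τ μ) ι))) (fun y y' => ((mQ₀ + oχ * βQ) + (mQ₁ + oχ₁ * βQ₁ + ct * mQ₀ + oχ₂ * βQ)) * Real.exp (-(δ * g.dist y y'))) := fun μ => by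
    rw [LinearMap.comp_assoc, LinearMap.comp_assoc]
    exact hasMaj_idef_smoothCut_flat blk π (S := S) (N := N ∘ₗ bgrad n (liftEquiv (τ μ) ι)) (N' := N' ∘ₗ bgrad n' (liftEquiv (τ' μ) ι)) hβQ hβQ₁ hct hmQ₀ hmQ₁ hoχ hoχ₁ hoχ₂ hχt' hfitχ hsub hsub' (hcutQb μ) (hDcutQb μ)
  have hDDQb : ∀ μ (j : J ⊕ J), HasMaj (BlockNorm.ofBlocks g (liftBlk blk ι)) (BlockNorm.ofBlocks g (liftBlk (blk ∘ π) ι))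
      (idef (pull (liftMap π ι)) (pull (liftMap π ι)) ((Sum.elim (fun μ => fgrad n' (liftEquiv (τ' μ) ι)) (fun μ => bgrad n' (liftEquiv (τ' μ) ι)) j ∘ₗ (mulOp (fun p : X' × ι => χtX' p.1) ∘ₗ N')) ∘ₗ bgrad n' (liftEquiv (τ' μ) ι)) ((Sum.elim (fun μ => fgrad n (liftEquiv (τ μ) ι)) (fun μ => bgrad n (liftEquiv (τ μ) ι)) j ∘ₗ (mulOp (fun p : X × ι => χtX p.1) ∘ₗ N)) ∘ₗ bgrad n (liftEquiv (τ μ) ι))) (fun y y' => ((mQ₀ + oχ * βQ) + (mQ₁ + oχ₁ * βQ₁ + ct * mQ₀ + oχ₂ * βQ)) * Real.exp (-(δ * g.dist y y'))) := fun μ j => by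
    rw [LinearMap.comp_assoc, LinearMap.comp_assoc, LinearMap.comp_assoc, LinearMap.comp_assoc]
    exact hasMaj_idef_jet_smoothCut_flat blk π τ τ' n n' (S := S) (N := N ∘ₗ bgrad n (liftEquiv (τ μ) ι)) (N' := N' ∘ₗ bgrad n' (liftEquiv (τ' μ) ι)) hβQ hβQ₁ hct hmQ₀ hmQ₁ hoχ hoχ₁ hoχ₂ hχt' hdχt' hdχtb' hfit₁ hfit₁b hfit₂ hfit₂b
      hs hsb hdd hddb hs' hsb' hdd' hddb' (hcutQb μ) (hcutFQb μ) (hcutBQb μ) (hDcutQb μ) (hDcutFQb μ) (hDcutBQb μ) j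
  exact hasMaj_idef_dressedV_comp_commOp_cubeOp_out blk π τ τ' n n' C C' A A' hX hX' htri hd hsymm hrow hσ hcr hβb hβQb hR ho hmGb hmQGb hσρ hρ₁V hρ₁G hρ₂ hρ₂₁ hρ₃ hρ₃N
    hρ₃V hρ₃₂ hε hc₀ hc₁ hc₂ ho₀ ho₁ ho₂ hoo hrW hrA hoAt hcN hrN hcV hrV hℓ hω (fun _ => rfl) (fun _ => rfl) (fun _ => rfl) (fun _ => rfl) (fun _ => rfl) (fun _ => rfl) hSχ hSψ
    hSψ₂ hSχ' hSψ' hSψ₂' hmf hmb hmf' hmb' (smoothCut_out hχ) (smoothCut_in hNψ) (smoothCut_out hχ') (smoothCut_in hNψ') hh1v hh1bv hh2 hh2f hh2b hF0 hF1 hF2 hF3 hF4 hh1 hh1b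
    hh0 hh1' hh1b' hh0' hf1 hf1b hf0 hf0b hfit hLip hrh hrh' hA hfAb hfAf hG hD hG' hD' hDG hDD hGQf hDQf hGQb hDQb hGQf' hDQf' hGQb' hDQb' hDGQf hDDQf hDGQb hDDQb hV hV' hDV
    hq hDW hKN hDKN hNV hNV' hDNV

end Summit.QuantumFields.YangMills.BalabanUVNodes.N15.CurvedSpecies

end
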